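import Summits.AtomisticToContinuum.Crystallization.Theorems.HullExactificationCascadeRobustBarlowTemplateTransportSteps1
import Summits.AtomisticToContinuum.Crystallization.Theorems.HullExactificationCascadeRobustBarlowTemplateTransportSteps2
import Summits.AtomisticToContinuum.Crystallization.Theorems.HullExactificationCascadeRobustBarlowTemplateTransportSteps3
import Summits.AtomisticToContinuum.Crystallization.Theorems.HullExactificationCascadeRobustBarlowTemplateTransportComm1
import Summits.AtomisticToContinuum.Crystallization.Theorems.HullExactificationCascadeRobustBarlowTemplateTransportGlobalA
import Summits.AtomisticToContinuum.Crystallization.Theorems.HullExactificationCascadeRobustBarlowTemplateTransportGlobalB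
import Summits.AtomisticToContinuum.Crystallization.Theorems.HullExactificationCascadeRobustBarlowTemplateTransportGlobalC
import Summits.AtomisticToContinuum.Crystallization.Theorems.HullExactificationCascadeRobustBarlowTemplateTransportGlobalD
import Summits.AtomisticToContinuum.Crystallization.Theorems.HullExactificationCascadeRobustBarlowTemplateTransportGlobalE
import Summits.AtomisticToContinuum.Crystallization.Theorems.PalmUnimodularRigidityShellsToBarlowChartTransportGlobalF

/-!
# Line `registered` (crux `RobustBarlowTemplate`, stmt-AtomisticToContinuum-12088): STAR and LINK at every frame of the development

Helper lemmas for `develop_transport` (the geometric half of the development): frames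
`⟨x, t₁, t₂, U⟩` read in the scale-relative integer charts `IsZChart` of an everywhere-good
configuration, their transports and the coherence of the resulting development `frameAt`.  The
only metric inputs are the chart transfer lemma `develop_transfer` and `bond_nb_iff`; everything
else is label combinatorics in `ℤ³` (pattern facts `TransportPatterns*` of the sibling crux 9227,
imported verbatim).  All `[folklore]` (HalesDSP2012 §1.3 for the two kissing patterns).

PORT of `PalmUnimodularRigidityShellsToBarlowChartTransportGlobalF.lean` (closed sibling crux
`ShellsToBarlowChart`, stmt-9227) to the SCALE-RELATIVE shell relation `y ∈ shell S x` and the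
five-argument charts `IsZChart S x P A nbr` of this crux; the port rules (conjunct paths,
`bond a b ↦ b ∈ shell S a`, the threaded symmetry hypothesis `hsy` replacing `bond_symm`,
`zchart_transfer` / `zchart_sqNormInt_eq`, the `open … hiding …` line) are listed under
"Port notes" in `…RobustBarlowTemplateTransportSteps1.lean` (and `…Steps6`, `…Attach1`, `…GlobalD`,
`…GlobalA`, `…GlobalB`, `…GlobalC`).

## Port notes (this part: `TransportGlobalF`)
* the signatures of `sites`, `par_IJ`, `lowerParity_eq_par_below`, `star_at` are parallel to the
  source with `hsy` inserted right after `hch` (passed on to `layers`, `sites_inlayer`, `up_of_V`,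
  `up_of_Vinv`, `down_of_V`, `down_of_Vinv`, `nbhd`, `Istep_spec`, `Jstep_spec`, `sites`);
* `star_at`: the bonded-neighbour set `{z | z ∈ S ∧ (0 < dist x z ∧ dist x z ≤ 28/25)}` of the
  STAR conjunct became `shell S x` and the bond of the LINK conjunct became the shell membership
  `(frameAt … y').pt ∈ shell S (frameAt … y).pt` (the two clauses of our `TransportSystem`, as in
  our `star_core`); otherwise the proofs are the source proofs verbatim;
* the CHART-AGNOSTIC lemma `int_cases'` of the source part is NOT re-proved (the gate forbids
  restating landed declarations): it is used from the source module
  `…ShellsToBarlowChartTransportGlobalF`, imported for that purpose; since that import makes the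
  9227 `GlobalA–F` visible, the `open … hiding …` line (the union of those of our
  `…TransportGlobalC` and `…TransportGlobalD`) is EXTENDED by the 9227 names `sites_inlayer`,
  `up_of_V`, `up_of_Vinv`, `down_of_Vinv`, `down_of_V` (part `GlobalE`) and `sites`, `par_IJ`,
  `lowerParity_eq_par_below`, `star_at` (this part);
* imports: our parts 1, 2, 3, `Comm1`, `GlobalA–E` (as in the source) and the 9227 `GlobalF`;
* the anchor at the end (explicit-`∀` form of `lowerParity_eq_par_below`, registered sub-goal)
  is new.
-/

noncomputable section

namespace Summit.AtomisticToContinuum.Crystallization.Theorems.HullExactificationCascadeRobustBarlowTemplate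

open Literature.Geometry.DiscreteGeometry Literature.MathematicalPhysics.StatisticalMechanics
open Summit.AtomisticToContinuum.Crystallization.Theorems.PalmUnimodularRigidityShellsToBarlowChart hiding
  IsZChart TransportSystem scales_tied sqNormInt_transfer bond_symm nb_mem zlab_spec zlab_nb bond_nb_iff
  pattern_cases transfer_nb_nb transfer_nb_centre transfer_nb_target sqNormInt_zlab_centre hcp_of_mirror_pair
  Istep_spec Jstep_spec IinvStep_spec JinvStep_spec capWithAny_of_mem_cap IinvStep_Istep Istep_IinvStep
  JinvStep_Jstep Jstep_JinvStep polar_at_apex onesided_at_apex nb_inj Istep_lower Jstep_lower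
  IinvStep_lower JinvStep_lower Vstep_spec polar_at_lower_apex onesided_at_lower_apex VinvStep_spec
  attach_I_even attach_I_odd attach_lower_I_pos attach_lower_I_neg attach_J_even attach_J_odd
  Vstep_Istep_pt Vstep_Istep_back Vstep_Istep_side Vstep_Jstep_pt Vstep_Istep_comm Vstep_Jstep_comm
  attach_lower_J_pos attach_lower_J_neg VinvStep_Istep_pt VinvStep_Jstep_pt VinvStep_Istep_back
  VinvStep_Istep_side Istep_Jstep_comm line_I line_J adm_transports layer_zero back_I back_J nbhd
  layer_up layer_down layers star_core table_fcc_p table_fcc_m table_hcp_p table_hcp_m sites_inlayer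
  up_of_V up_of_Vinv down_of_Vinv down_of_V sites par_IJ lowerParity_eq_par_below star_at

variable {S : Set (EuclideanSpace ℝ (Fin 3))} {Pc : (EuclideanSpace ℝ (Fin 3)) → Finset (Fin 3 → ℤ)}
  {Ac : (EuclideanSpace ℝ (Fin 3)) → ((EuclideanSpace ℝ (Fin 3)) →ₗᵢ[ℝ] (EuclideanSpace ℝ (Fin 3)))} {nb : (EuclideanSpace ℝ (Fin 3)) → (Fin 3 → ℤ) → (EuclideanSpace ℝ (Fin 3))}

/-- **The twelve neighbour sites of a frame of the development, by label.**  For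
`⟨x, t₁, t₂, U⟩ = frameAt g₀ k i j` with apexes `c` (upper cap) and `d` (lower cap): the sites at
`(k, i±1, j)`, `(k, i, j±1)`, `(k, i∓1, j±1)`, `(k+1, ·)`, `(k−1, ·)` carry the expected labels.
[folklore] -/
theorem sites (hch : ∀ z ∈ S, IsZChart S z (Pc z) (Ac z) (nb z))
    (hsy : ∀ x ∈ S, ∀ y ∈ shell S x, x ∈ shell S y) {g₀ : ZFrame}
    (h₀ : IsFrame (Pc g₀.pt) g₀.t₁ g₀.t₂ g₀.U) (h₀S : g₀.pt ∈ S) (h₀p : frameParity g₀.t₁ g₀.t₂ g₀.U = 1)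
    (h₀A : (∀ z ∈ S, Pc z = fcc3Int) ∨ Pc g₀.pt = hcpInt) (k i j : ℤ) {x : (EuclideanSpace ℝ (Fin 3))} {t₁ t₂ : Fin 3 → ℤ}
    {U : Finset (Fin 3 → ℤ)} (h : frameAt Pc nb g₀ k i j = ⟨x, t₁, t₂, U⟩) :
    (frameAt Pc nb g₀ k (i + 1) j).pt = nb x t₁ ∧ (frameAt Pc nb g₀ k (i - 1) j).pt = nb x (-t₁) ∧
    (frameAt Pc nb g₀ k i (j + 1)).pt = nb x t₂ ∧ (frameAt Pc nb g₀ k i (j - 1)).pt = nb x (-t₂) ∧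
    (frameAt Pc nb g₀ k (i - 1) (j + 1)).pt = nb x (t₂ - t₁) ∧
    (frameAt Pc nb g₀ k (i + 1) (j - 1)).pt = nb x (t₁ - t₂) ∧
    (frameAt Pc nb g₀ (k + 1) i j).pt = nb x (apexOf t₁ t₂ U) ∧
    (frameParity t₁ t₂ U = 1 → (frameAt Pc nb g₀ (k + 1) (i - 1) j).pt = nb x (apexOf t₁ t₂ U - t₁) ∧
      (frameAt Pc nb g₀ (k + 1) i (j - 1)).pt = nb x (apexOf t₁ t₂ U - t₂)) ∧
    (frameParity t₁ t₂ U = -1 → (frameAt Pc nb g₀ (k + 1) (i + 1) j).pt = nb x (apexOf t₁ t₂ U + t₁) ∧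
      (frameAt Pc nb g₀ (k + 1) i (j + 1)).pt = nb x (apexOf t₁ t₂ U + t₂)) ∧
    (frameAt Pc nb g₀ (k - 1) i j).pt = nb x (apexOf t₁ t₂ (lowerCap (Pc x) t₁ t₂ U)) ∧
    (lowerParity t₁ t₂ (lowerCap (Pc x) t₁ t₂ U) = 1 →
      (frameAt Pc nb g₀ (k - 1) (i + 1) j).pt = nb x (apexOf t₁ t₂ (lowerCap (Pc x) t₁ t₂ U) + t₁) ∧
      (frameAt Pc nb g₀ (k - 1) i (j + 1)).pt = nb x (apexOf t₁ t₂ (lowerCap (Pc x) t₁ t₂ U) + t₂)) ∧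
    (lowerParity t₁ t₂ (lowerCap (Pc x) t₁ t₂ U) = -1 →
      (frameAt Pc nb g₀ (k - 1) (i - 1) j).pt = nb x (apexOf t₁ t₂ (lowerCap (Pc x) t₁ t₂ U) - t₁) ∧
      (frameAt Pc nb g₀ (k - 1) i (j - 1)).pt = nb x (apexOf t₁ t₂ (lowerCap (Pc x) t₁ t₂ U) - t₂)) := by
  obtain ⟨hval, hS, hI, hJ, -, -⟩ := layers (Pc := Pc) (nb := nb) hch hsy h₀ h₀S h₀p h₀A
  obtain ⟨e1, e2, e3, e4, e5, e6⟩ := sites_inlayer hch hsy (hval k) (hS k) (hI k) (hJ k) i j h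
  refine ⟨e1, e2, e3, e4, e5, e6, ?_⟩
  -- upper part
  have hup : (frameAt Pc nb g₀ (k + 1) i j).pt = nb x (apexOf t₁ t₂ U) ∧
      (frameParity t₁ t₂ U = 1 → (frameAt Pc nb g₀ (k + 1) (i - 1) j).pt = nb x (apexOf t₁ t₂ U - t₁) ∧
        (frameAt Pc nb g₀ (k + 1) i (j - 1)).pt = nb x (apexOf t₁ t₂ U - t₂)) ∧
      (frameParity t₁ t₂ U = -1 → (frameAt Pc nb g₀ (k + 1) (i + 1) j).pt = nb x (apexOf t₁ t₂ U + t₁) ∧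
        (frameAt Pc nb g₀ (k + 1) i (j + 1)).pt = nb x (apexOf t₁ t₂ U + t₂)) := by
    rcases int_cases k with ⟨n, rfl⟩ | ⟨m, rfl⟩
    · have E := up_of_V hch hsy (hval n) (hS n) (hI n) (hJ n) i j h
      simp only [frameAt_natSucc]
      exact E
    · have h' : VinvStep Pc nb (frameAt Pc nb g₀ (-(m : ℤ)) i j) = ⟨x, t₁, t₂, U⟩ := by
        rw [← frameAt_negSucc]; exact h
      have E := up_of_Vinv hch hsy (hval (-(m : ℤ))) (hS (-(m : ℤ))) (hI (-(m : ℤ))) (hJ (-(m : ℤ))) i j h'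
      rw [show -((m : ℤ) + 1) + 1 = -(m : ℤ) by ring]
      exact E
  -- lower part
  have hdn : (frameAt Pc nb g₀ (k - 1) i j).pt = nb x (apexOf t₁ t₂ (lowerCap (Pc x) t₁ t₂ U)) ∧
      (lowerParity t₁ t₂ (lowerCap (Pc x) t₁ t₂ U) = 1 →
        (frameAt Pc nb g₀ (k - 1) (i + 1) j).pt = nb x (apexOf t₁ t₂ (lowerCap (Pc x) t₁ t₂ U) + t₁) ∧
        (frameAt Pc nb g₀ (k - 1) i (j + 1)).pt = nb x (apexOf t₁ t₂ (lowerCap (Pc x) t₁ t₂ U) + t₂)) ∧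
      (lowerParity t₁ t₂ (lowerCap (Pc x) t₁ t₂ U) = -1 →
        (frameAt Pc nb g₀ (k - 1) (i - 1) j).pt = nb x (apexOf t₁ t₂ (lowerCap (Pc x) t₁ t₂ U) - t₁) ∧
        (frameAt Pc nb g₀ (k - 1) i (j - 1)).pt = nb x (apexOf t₁ t₂ (lowerCap (Pc x) t₁ t₂ U) - t₂)) := by
    rcases int_cases' k with ⟨n, rfl⟩ | ⟨m, rfl⟩
    · have h' : Vstep Pc nb (frameAt Pc nb g₀ (n : ℤ) i j) = ⟨x, t₁, t₂, U⟩ := by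
        rw [← frameAt_natSucc]; exact h
      have E := down_of_V hch hsy (hval n) (hS n) (hI n) (hJ n) i j h'
      rw [show (n : ℤ) + 1 - 1 = (n : ℤ) by ring]
      exact E
    · have E := down_of_Vinv hch hsy (hval (-(m : ℤ))) (hS (-(m : ℤ))) (hI (-(m : ℤ))) (hJ (-(m : ℤ))) i j h
      rw [show -(m : ℤ) - 1 = -((m : ℤ) + 1) by ring]
      simp only [frameAt_negSucc]
      exact E
  exact ⟨hup.1, hup.2.1, hup.2.2, hdn.1, hdn.2.1, hdn.2.2⟩

/-- Parity is constant along `I` and `J` in the development. [folklore] -/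
theorem par_IJ (hch : ∀ z ∈ S, IsZChart S z (Pc z) (Ac z) (nb z))
    (hsy : ∀ x ∈ S, ∀ y ∈ shell S x, x ∈ shell S y) {g₀ : ZFrame}
    (h₀ : IsFrame (Pc g₀.pt) g₀.t₁ g₀.t₂ g₀.U) (h₀S : g₀.pt ∈ S) (h₀p : frameParity g₀.t₁ g₀.t₂ g₀.U = 1)
    (h₀A : (∀ z ∈ S, Pc z = fcc3Int) ∨ Pc g₀.pt = hcpInt) (k i j : ℤ) :
    frameParity (frameAt Pc nb g₀ k (i + 1) j).t₁ (frameAt Pc nb g₀ k (i + 1) j).t₂ (frameAt Pc nb g₀ k (i + 1) j).U =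
      frameParity (frameAt Pc nb g₀ k i j).t₁ (frameAt Pc nb g₀ k i j).t₂ (frameAt Pc nb g₀ k i j).U ∧
    frameParity (frameAt Pc nb g₀ k i (j + 1)).t₁ (frameAt Pc nb g₀ k i (j + 1)).t₂ (frameAt Pc nb g₀ k i (j + 1)).U =
      frameParity (frameAt Pc nb g₀ k i j).t₁ (frameAt Pc nb g₀ k i j).t₂ (frameAt Pc nb g₀ k i j).U := by
  obtain ⟨hval, hS, hI, hJ, -, -⟩ := layers (Pc := Pc) (nb := nb) hch hsy h₀ h₀S h₀p h₀A
  rcases h : frameAt Pc nb g₀ k i j with ⟨x, t₁, t₂, U⟩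
  obtain ⟨hx, hU, hIg, hJg, -⟩ := nbhd hch hsy (hval k) (hS k) (hI k) (hJ k) i j h
  obtain ⟨-, -, -, -, -, -, -, -, -, -, -, -, hparI, -⟩ :=
    Istep_spec hch hsy hx hU (hregI_of_valid (Pc := Pc) (nb := nb) hIg)
  obtain ⟨-, -, -, -, -, -, -, -, -, -, -, -, hparJ, -⟩ :=
    Jstep_spec hch hsy hx hU (hregJ_of_valid (Pc := Pc) (nb := nb) hJg)
  constructor
  · rw [hI k i j, h]; exact hparI
  · rw [hJ k i j, h]; exact hparJ

/-- The letter read below a frame of the development is the parity of the frame one layer down.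
[folklore] -/
theorem lowerParity_eq_par_below (hch : ∀ z ∈ S, IsZChart S z (Pc z) (Ac z) (nb z))
    (hsy : ∀ x ∈ S, ∀ y ∈ shell S x, x ∈ shell S y) {g₀ : ZFrame}
    (h₀ : IsFrame (Pc g₀.pt) g₀.t₁ g₀.t₂ g₀.U) (h₀S : g₀.pt ∈ S) (h₀p : frameParity g₀.t₁ g₀.t₂ g₀.U = 1)
    (h₀A : (∀ z ∈ S, Pc z = fcc3Int) ∨ Pc g₀.pt = hcpInt) (k i j : ℤ) :
    lowerParity (frameAt Pc nb g₀ k i j).t₁ (frameAt Pc nb g₀ k i j).t₂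
        (lowerCap (Pc (frameAt Pc nb g₀ k i j).pt) (frameAt Pc nb g₀ k i j).t₁ (frameAt Pc nb g₀ k i j).t₂
          (frameAt Pc nb g₀ k i j).U) =
      frameParity (frameAt Pc nb g₀ (k - 1) i j).t₁ (frameAt Pc nb g₀ (k - 1) i j).t₂ (frameAt Pc nb g₀ (k - 1) i j).U := by
  obtain ⟨-, -, -, -, hupL, hdnL⟩ := layers (Pc := Pc) (nb := nb) hch hsy h₀ h₀S h₀p h₀A
  rcases int_cases' k with ⟨n, rfl⟩ | ⟨m, rfl⟩
  · rw [show (n : ℤ) + 1 - 1 = (n : ℤ) by ring]; exact hupL n i j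
  · rw [show -(m : ℤ) - 1 = -((m : ℤ) + 1) by ring]; exact (hdnL m i j).symm

/-- **STAR and LINK at every frame of the development.** [folklore] -/
theorem star_at (hch : ∀ z ∈ S, IsZChart S z (Pc z) (Ac z) (nb z))
    (hsy : ∀ x ∈ S, ∀ y ∈ shell S x, x ∈ shell S y) {g₀ : ZFrame}
    (h₀ : IsFrame (Pc g₀.pt) g₀.t₁ g₀.t₂ g₀.U) (h₀S : g₀.pt ∈ S) (h₀p : frameParity g₀.t₁ g₀.t₂ g₀.U = 1)
    (h₀A : (∀ z ∈ S, Pc z = fcc3Int) ∨ Pc g₀.pt = hcpInt) (k i j : ℤ) {x : (EuclideanSpace ℝ (Fin 3))} {t₁ t₂ : Fin 3 → ℤ}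
    {U : Finset (Fin 3 → ℤ)} (h : frameAt Pc nb g₀ k i j = ⟨x, t₁, t₂, U⟩) {σm σp : ℤ}
    (hσp : frameParity t₁ t₂ U = σp) (hσm : lowerParity t₁ t₂ (lowerCap (Pc x) t₁ t₂ U) = σm) :
    Set.BijOn (fun y : ℤ × ℤ × ℤ => (frameAt Pc nb g₀ (k + y.1) (i - y.2.1) (j - y.2.2)).pt)
      (↑(linkOffsets σm σp) : Set (ℤ × ℤ × ℤ)) (shell S x) ∧
    ∀ y ∈ linkOffsets σm σp, ∀ y' ∈ linkOffsets σm σp,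
      ((frameAt Pc nb g₀ (k + y'.1) (i - y'.2.1) (j - y'.2.2)).pt ∈
          shell S (frameAt Pc nb g₀ (k + y.1) (i - y.2.1) (j - y.2.2)).pt ↔ linkAdj σm σp y y') := by
  obtain ⟨hval, hS, hI, hJ, -, -⟩ := layers (Pc := Pc) (nb := nb) hch hsy h₀ h₀S h₀p h₀A
  have hx : x ∈ S := by have := hS k i j; rw [h] at this; exact this
  have hU : IsFrame (Pc x) t₁ t₂ U := by have := hval k i j; rw [h] at this; exact this
  have hPx := pattern_cases hch hx
  obtain ⟨e1, e2, e3, e4, e5, e6, eU, eUp, eUm, eD, eDp, eDm⟩ := sites hch hsy h₀ h₀S h₀p h₀A k i j h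
  -- the label map and the site identities
  set c := apexOf t₁ t₂ U with hc
  set d := apexOf t₁ t₂ (lowerCap (Pc x) t₁ t₂ U) with hd
  have hΦ : ∀ y ∈ linkOffsets σm σp, (frameAt Pc nb g₀ (k + y.1) (i - y.2.1) (j - y.2.2)).pt =
      nb x ((if y.1 = 1 then c else if y.1 = -1 then d else 0) - y.2.1 • t₁ - y.2.2 • t₂) := by
    intro y hy
    simp only [linkOffsets, Finset.mem_union, Finset.mem_image] at hy
    rcases hy with (⟨PQ, hPQ, rfl⟩ | ⟨PQ, hPQ, rfl⟩) | ⟨PQ, hPQ, rfl⟩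
    · simp only [sixOffsets, Finset.mem_insert, Finset.mem_singleton] at hPQ
      rcases hPQ with rfl | rfl | rfl | rfl | rfl | rfl
      · norm_num; exact e2
      · norm_num; exact e1
      · norm_num; exact e4
      · norm_num; exact e3
      · norm_num; rw [e5]; congr 1; abel
      · norm_num; rw [e6]
    · -- upper layer: offsets `threeOffsets (−σp)`
      rcases frameParity_eq_or t₁ t₂ U with hp | hp <;> rw [← hσp, hp] at hPQ
      · obtain ⟨f1, f2⟩ := eUp hp
        simp only [threeOffsets, Finset.mem_insert, Finset.mem_singleton, show ¬((-1 : ℤ) = 1) by decide,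
          if_false] at hPQ
        rcases hPQ with rfl | rfl | rfl
        · norm_num; exact eU
        · norm_num; rw [f1]
        · norm_num; rw [f2]
      · obtain ⟨f1, f2⟩ := eUm hp
        simp only [threeOffsets, Finset.mem_insert, Finset.mem_singleton, neg_neg, if_true] at hPQ
        rcases hPQ with rfl | rfl | rfl
        · norm_num; exact eU
        · norm_num; rw [f1]
        · norm_num; rw [f2]
    · -- lower layer: offsets `threeOffsets σm`
      rcases lowerParity_eq_or t₁ t₂ (lowerCap (Pc x) t₁ t₂ U) with hp | hp <;> rw [← hσm, hp] at hPQ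
      · obtain ⟨f1, f2⟩ := eDp hp
        simp only [threeOffsets, Finset.mem_insert, Finset.mem_singleton, if_true] at hPQ
        rcases hPQ with rfl | rfl | rfl
        · norm_num; rw [show k + -1 = k - 1 by ring]; exact eD
        · norm_num; rw [show k + -1 = k - 1 by ring]; exact f1
        · norm_num; rw [show k + -1 = k - 1 by ring]; exact f2
      · obtain ⟨f1, f2⟩ := eDm hp
        simp only [threeOffsets, Finset.mem_insert, Finset.mem_singleton, show ¬((-1 : ℤ) = 1) by decide,
          if_false] at hPQ
        rcases hPQ with rfl | rfl | rfl
        · norm_num; rw [show k + -1 = k - 1 by ring]; exact eD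
        · norm_num; rw [show k + -1 = k - 1 by ring]; exact f1
        · norm_num; rw [show k + -1 = k - 1 by ring]; exact f2
  -- the table for the four letter patterns
  have hcardP : (Pc x).card = 12 := by
    rcases hPx with hP | hP <;> rw [hP] <;> decide
  rcases hPx with hP | hP
  · rcases frameParity_eq_or t₁ t₂ U with hp | hp
    · obtain ⟨hlp, hdd, himg, hrows⟩ := table_fcc_p hch hx hU hP hp
      have hσm' : σm = 1 := by rw [← hσm, hlp]
      have hσp' : σp = 1 := by rw [← hσp, hp]
      subst hσm' hσp'
      rw [← hd, ← hc] at hdd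
      rw [← hc, ← hdd] at himg hrows
      exact star_core hch hx _ himg hrows (card_linkOffsets 1 (by simp) 1 (by simp)) hcardP _ hΦ
    · obtain ⟨hlp, hdd, himg, hrows⟩ := table_fcc_m hch hx hU hP hp
      have hσm' : σm = -1 := by rw [← hσm, hlp]
      have hσp' : σp = -1 := by rw [← hσp, hp]
      subst hσm' hσp'
      rw [← hd, ← hc] at hdd
      rw [← hc, ← hdd] at himg hrows
      exact star_core hch hx _ himg hrows (card_linkOffsets (-1) (by simp) (-1) (by simp)) hcardP _ hΦ
  · rcases frameParity_eq_or t₁ t₂ U with hp | hp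
    · obtain ⟨hlp, hdd, himg, hrows⟩ := table_hcp_p hch hx hU hP hp
      have hσm' : σm = -1 := by rw [← hσm, hlp]
      have hσp' : σp = 1 := by rw [← hσp, hp]
      subst hσm' hσp'
      rw [← hd, ← hc] at hdd
      rw [← hc, ← hdd] at himg hrows
      exact star_core hch hx _ himg hrows (card_linkOffsets (-1) (by simp) 1 (by simp)) hcardP _ hΦ
    · obtain ⟨hlp, hdd, himg, hrows⟩ := table_hcp_m hch hx hU hP hp
      have hσm' : σm = 1 := by rw [← hσm, hlp]
      have hσp' : σp = -1 := by rw [← hσp, hp]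
      subst hσm' hσp'
      rw [← hd, ← hc] at hdd
      rw [← hc, ← hdd] at himg hrows
      exact star_core hch hx _ himg hrows (card_linkOffsets 1 (by simp) (-1) (by simp)) hcardP _ hΦ

/-! ## Anchor -/

/-- Anchor (registered sub-goal of stmt-AtomisticToContinuum-12088, toward `develop_transport`):
the letter read below a frame of the development is the parity of the frame one layer down
(explicit form of `lowerParity_eq_par_below`). [folklore] -/
theorem transportGlobalF_anchor : ∀ (S : Set (EuclideanSpace ℝ (Fin 3))) (Pc : EuclideanSpace ℝ (Fin 3) → Finset (Fin 3 → ℤ)) (Ac : EuclideanSpace ℝ (Fin 3) → (EuclideanSpace ℝ (Fin 3) →ₗᵢ[ℝ] EuclideanSpace ℝ (Fin 3))) (nb : EuclideanSpace ℝ (Fin 3) → (Fin 3 → ℤ) → EuclideanSpace ℝ (Fin 3)), (∀ z ∈ S, IsZChart S z (Pc z) (Ac z) (nb z)) → (∀ x ∈ S, ∀ y ∈ shell S x, x ∈ shell S y) → ∀ g₀ : ZFrame, IsFrame (Pc g₀.pt) g₀.t₁ g₀.t₂ g₀.U → g₀.pt ∈ S → frameParity g₀.t₁ g₀.t₂ g₀.U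 = 1 → ((∀ z ∈ S, Pc z = fcc3Int) ∨ Pc g₀.pt = hcpInt) → ∀ k i j : ℤ, lowerParity (frameAt Pc nb g₀ k i j).t₁ (frameAt Pc nb g₀ k i j).t₂ (lowerCap (Pc (frameAt Pc nb g₀ k i j).pt) (frameAt Pc nb g₀ k i j).t₁ (frameAt Pc nb g₀ k i j).t₂ (frameAt Pc nb g₀ k i j).U) = frameParity (frameAt Pc nb g₀ (k - 1) i j).t₁ (frameAt Pc nb g₀ (k - 1) i j).t₂ (frameAt Pc nb g₀ (k - 1) i j).U :=
  fun _ _ _ _ hch hsy _ h₀ h₀S h₀p h₀A k i j => lowerParity_eq_par_below hch hsy h₀ h₀S h₀p h₀A k i j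

end Summit.AtomisticToContinuum.Crystallization.Theorems.HullExactificationCascadeRobustBarlowTemplate

end
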